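import Literature.MathematicalPhysics.QuantumFieldTheory.OSLocalTube
import Literature.MathematicalPhysics.QuantumLattice.TubeBoundaryValueLocal
import HarnessLib

/-!
# Two-dimensional local cones for the symmetry of the Schwinger functions

Topic `Literature/MathematicalPhysics/QuantumLattice` (trunk T-AQFT). Elementary geometry in
space-time dimension `1 + 1` used by `SchwingerSymmetryTwoDim` (the case `d = 1` of
`IsWickRotationOf.schwinger_symmetric`; OS I §5 p. 97, S–W Thm. 3-6):

* explicit forward-cone margins, space-like vectors and imaginary boosts in `d = 1`
  (`coneMargin_one`, `isSpacelike_of_abs_lt_abs`, `imPart_boost_apply_zero/one`,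
  `rePart_boost_apply_zero/one`);
* the **two-generator cone** `twoGenCone Y₁ Y₂ κ` of imaginary parts
  `{η | η⁰ ≈ a Y₁ + b Y₂, η¹ ≈ 0 (errors < κ(a + b)), a, b ≥ 0, a + b > 0}`: open, convex, a cone,
  not containing `0`, with the comparison `(a + b)/4 ≤ ‖η‖ ≤ (a + b)(Yb + 1)` between the
  parameters and the norm, and containing the two generating directions `Y₁ e₀`, `Y₂ e₀`;
* the **margin estimate for boosted permuted points** (`coneMargin_boost_ge_of_approx`): if the
  boosted imaginary times are within `e` of a sequence `A` with `succDiff A ≥ g` and the boosted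
  imaginary positions are at most `e`, all margins of the boosted configuration are `≥ g − 4e`;
  and the **ray form** of a complex configuration with margins `≥ κ₃ t` (`exists_ray_form`).

## References

* K. Osterwalder, R. Schrader, Comm. Math. Phys. 31 (1973), §5 p. 97. [OsterwalderSchraderCMP1973]
* R. F. Streater, A. S. Wightman, *PCT, Spin and Statistics, and All That* (1964), §2-4, Thm. 3-6.
  [StreaterWightman1964]
-/

noncomputable section

open Complex Set Metric
open Literature.MathematicalPhysics.QuantumFieldTheory

namespace Literature.MathematicalPhysics.QuantumLattice

variable {n : ℕ}

/-! ### Space-time dimension `1 + 1`: margins, space-like vectors, boosts -/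

/-- In `d = 1` the spatial part has norm `|v¹|`. [folklore] -/
theorem norm_spaceC_one (v : SpaceTime 1) : ‖spaceC 1 v‖ = |v 1| := by
  rw [EuclideanSpace.norm_eq, Fin.sum_univ_one, spaceC_apply, Real.norm_eq_abs, sq_abs,
    Real.sqrt_sq_eq_abs]
  rfl

/-- In `d = 1` the margin of `v` is `v⁰ − |v¹|`. [folklore] -/
theorem coneMargin_one (v : SpaceTime 1) : coneMargin v = v 0 - |v 1| := by
  rw [coneMargin, norm_spaceC_one]

/-- In `d = 1`, `|v⁰| < |v¹|` implies that `v` is space-like. [folklore] -/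
theorem isSpacelike_of_abs_lt_abs {v : SpaceTime 1} (h : |v 0| < |v 1|) : IsSpacelike v := by
  rw [IsSpacelike, minkowskiForm_self, norm_spaceC_one, sq_abs]
  have h1 : v 0 ^ 2 < v 1 ^ 2 := by
    have := abs_nonneg (v 0)
    nlinarith [sq_abs (v 0), sq_abs (v 1)]
  linarith

/-- The norm of a vector of `ℝ²` is at most the sum of the absolute values of its coordinates.
[folklore] -/
theorem norm_le_abs_add_abs (v : SpaceTime 1) : ‖v‖ ≤ |v 0| + |v 1| := by
  rw [EuclideanSpace.norm_eq, Fin.sum_univ_two, Real.norm_eq_abs, Real.norm_eq_abs]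
  rw [Real.sqrt_le_left (by positivity)]
  nlinarith [abs_nonneg (v 0), abs_nonneg (v 1)]

/-- A coordinate is bounded by the norm. [folklore] -/
theorem abs_apply_le_norm' (v : SpaceTime 1) (μ : Fin 2) : |v μ| ≤ ‖v‖ :=
  abs_apply_le_norm v μ

section Boost

variable (φ : ℝ) (a b : SpaceTime 1)

/-- Time component of `Im B₀(iφ)(a + ib)` in `d = 1`: `cos φ b⁰ + sin φ a¹`. [folklore] -/
theorem imPart_boost_apply_zero :
    imPart (boostC 0 ((φ : ℂ) * I) (complexifyPoint a + (I : ℂ) • complexifyPoint b)) 0 =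
      Real.cos φ * b 0 + Real.sin φ * a 1 := by
  rw [imPart_boostC_add_I_smul]
  simp [e₀_apply]
  ring

/-- Space component of `Im B₀(iφ)(a + ib)` in `d = 1`: `cos φ b¹ + sin φ a⁰`. [folklore] -/
theorem imPart_boost_apply_one :
    imPart (boostC 0 ((φ : ℂ) * I) (complexifyPoint a + (I : ℂ) • complexifyPoint b)) 1 =
      Real.cos φ * b 1 + Real.sin φ * a 0 := by
  rw [imPart_boostC_add_I_smul]
  simp [e₀_apply]
  ring

/-- Time component of `Re B₀(iφ)(a + ib)` in `d = 1`: `cos φ a⁰ − sin φ b¹`. [folklore] -/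
theorem rePart_boost_apply_zero :
    rePart (boostC 0 ((φ : ℂ) * I) (complexifyPoint a + (I : ℂ) • complexifyPoint b)) 0 =
      Real.cos φ * a 0 - Real.sin φ * b 1 := by
  rw [rePart_boostC_add_I_smul]
  simp [e₀_apply]
  ring

/-- Space component of `Re B₀(iφ)(a + ib)` in `d = 1`: `cos φ a¹ − sin φ b⁰`. [folklore] -/
theorem rePart_boost_apply_one :
    rePart (boostC 0 ((φ : ℂ) * I) (complexifyPoint a + (I : ℂ) • complexifyPoint b)) 1 =
      Real.cos φ * a 1 - Real.sin φ * b 0 := by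
  rw [rePart_boostC_add_I_smul]
  simp [e₀_apply]
  ring

end Boost

/-- `cos (arctan u) ≥ 1/2` and `|sin (arctan u)| ≤ |u|` for `|u| ≤ 1`, and
`sin (arctan u) = u cos (arctan u)`. [folklore] -/
theorem cos_arctan_ge_half {u : ℝ} (hu : |u| ≤ 1) :
    1 / 2 ≤ Real.cos (Real.arctan u) ∧ Real.cos (Real.arctan u) ≤ 1 ∧
      Real.sin (Real.arctan u) = u * Real.cos (Real.arctan u) ∧ |Real.sin (Real.arctan u)| ≤ |u| := by
  have hc := Real.cos_arctan u
  have hs := Real.sin_arctan u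
  have h1 : (1 : ℝ) ≤ Real.sqrt (1 + u ^ 2) := by
    rw [Real.le_sqrt (by norm_num) (by positivity)]; nlinarith
  have h2 : Real.sqrt (1 + u ^ 2) ≤ 2 := by
    rw [Real.sqrt_le_left (by norm_num)]
    have : u ^ 2 ≤ 1 := by
      have := abs_nonneg u
      nlinarith [sq_abs u]
    linarith
  have hpos : 0 < Real.sqrt (1 + u ^ 2) := by positivity
  refine ⟨?_, ?_, ?_, ?_⟩
  · rw [hc, div_le_div_iff₀ (by norm_num) hpos]; linarith
  · rw [hc, div_le_one hpos]; exact h1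
  · rw [hs, hc]; ring
  · rw [hs, abs_div, abs_of_pos hpos, div_le_iff₀ hpos]
    nlinarith [abs_nonneg u]

/-! ### The two-generator cone of imaginary parts -/

/-- **The two-generator cone** with generators `Y₁, Y₂ : Fin n → ℝ` (imaginary times) and
tolerance `κ`: imaginary parts `η` with `|η⁰_k − (a Y₁ k + b Y₂ k)| < κ(a + b)` and
`|η¹_k| < κ(a + b)` for some `a, b ≥ 0` with `a + b > 0`. [folklore] -/
def twoGenCone (Y₁ Y₂ : Fin n → ℝ) (κ : ℝ) : Set (Fin n → SpaceTime 1) :=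
  {η | ∃ a b : ℝ, 0 ≤ a ∧ 0 ≤ b ∧ 0 < a + b ∧
    ∀ k, |η k 0 - (a * Y₁ k + b * Y₂ k)| < κ * (a + b) ∧ |η k 1| < κ * (a + b)}

section Cone

variable {Y₁ Y₂ : Fin n → ℝ} {κ : ℝ}

/-- Continuity of a coordinate of a point of a configuration. [folklore] -/
theorem continuous_apply_apply (k : Fin n) (μ : Fin 2) :
    Continuous fun η : Fin n → SpaceTime 1 => η k μ :=
  (EuclideanSpace.proj μ).continuous.comp (continuous_apply k)

/-- The two-generator cone is open. [folklore] -/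
theorem isOpen_twoGenCone : IsOpen (twoGenCone Y₁ Y₂ κ) := by
  have h : twoGenCone Y₁ Y₂ κ = ⋃ a : ℝ, ⋃ b : ℝ, {η : Fin n → SpaceTime 1 | 0 ≤ a ∧ 0 ≤ b ∧ 0 < a + b ∧
      ∀ k, |η k 0 - (a * Y₁ k + b * Y₂ k)| < κ * (a + b) ∧ |η k 1| < κ * (a + b)} := by
    ext η; simp [twoGenCone]
  rw [h]
  refine isOpen_iUnion fun a => isOpen_iUnion fun b => ?_
  refine isOpen_const.and (isOpen_const.and (isOpen_const.and ?_))
  rw [Set.setOf_forall]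
  refine isOpen_iInter_of_finite fun k => IsOpen.and ?_ ?_
  · exact isOpen_lt (continuous_abs.comp ((continuous_apply_apply k 0).sub continuous_const))
      continuous_const
  · exact isOpen_lt (continuous_abs.comp (continuous_apply_apply k 1)) continuous_const

/-- The two-generator cone is a cone. [folklore] -/
theorem smul_mem_twoGenCone {η : Fin n → SpaceTime 1} (hη : η ∈ twoGenCone Y₁ Y₂ κ) {c : ℝ}
    (hc : 0 < c) : c • η ∈ twoGenCone Y₁ Y₂ κ := by
  obtain ⟨a, b, ha, hb, hab, h⟩ := hη
  refine ⟨c * a, c * b, by positivity, by positivity, by nlinarith, fun k => ?_⟩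
  obtain ⟨h1, h2⟩ := h k
  simp only [Pi.smul_apply, PiLp.smul_apply, smul_eq_mul]
  constructor
  · have : c * η k 0 - (c * a * Y₁ k + c * b * Y₂ k) = c * (η k 0 - (a * Y₁ k + b * Y₂ k)) := by ring
    rw [this, abs_mul, abs_of_pos hc]
    nlinarith
  · rw [abs_mul, abs_of_pos hc]
    nlinarith

/-- The two-generator cone is convex. [folklore] -/
theorem convex_twoGenCone (hκ : 0 ≤ κ) : Convex ℝ (twoGenCone Y₁ Y₂ κ) := by
  intro η hη η' hη' p q hp hq hpq
  obtain ⟨a, b, ha, hb, hab, h⟩ := hη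
  obtain ⟨a', b', ha', hb', hab', h'⟩ := hη'
  refine ⟨p * a + q * a', p * b + q * b', by positivity, by positivity, ?_, fun k => ?_⟩
  · rcases hp.eq_or_lt with rfl | hp'
    · rw [zero_add] at hpq; subst hpq; nlinarith
    · nlinarith
  obtain ⟨h1, h2⟩ := h k
  obtain ⟨h1', h2'⟩ := h' k
  simp only [Pi.add_apply, Pi.smul_apply, PiLp.add_apply, PiLp.smul_apply, smul_eq_mul]
  have key : ∀ {u v U V : ℝ}, |u| < U → |v| < V → 0 ≤ U → 0 ≤ V →
      |p * u + q * v| < p * U + q * V := by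
    intro u v U V hu hv hU hV
    rcases hp.eq_or_lt with rfl | hp'
    · rw [zero_add] at hpq; subst hpq; simpa using hv
    · calc |p * u + q * v| ≤ |p * u| + |q * v| := abs_add_le _ _
        _ = p * |u| + q * |v| := by rw [abs_mul, abs_mul, abs_of_pos hp', abs_of_nonneg hq]
        _ < p * U + q * V := by
            have h3 : p * |u| < p * U := mul_lt_mul_of_pos_left hu hp'
            have h4 : q * |v| ≤ q * V := mul_le_mul_of_nonneg_left hv.le hq
            linarith
  constructor
  · have heq : p * η k 0 + q * η' k 0 - ((p * a + q * a') * Y₁ k + (p * b + q * b') * Y₂ k) =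
        p * (η k 0 - (a * Y₁ k + b * Y₂ k)) + q * (η' k 0 - (a' * Y₁ k + b' * Y₂ k)) := by ring
    rw [heq]
    have := key h1 h1' (by nlinarith) (by nlinarith)
    linarith
  · have := key h2 h2' (by nlinarith) (by nlinarith)
    linarith

/-- `0` is not in the two-generator cone when `n ≥ 1`, `Y₁, Y₂ ≥ 1/2` and `κ ≤ 1/4`. [folklore] -/
theorem zero_notMem_twoGenCone [NeZero n] (hY₁ : ∀ k, 1 / 2 ≤ Y₁ k) (hY₂ : ∀ k, 1 / 2 ≤ Y₂ k)
    (hκ : κ ≤ 1 / 4) : (0 : Fin n → SpaceTime 1) ∉ twoGenCone Y₁ Y₂ κ := by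
  rintro ⟨a, b, ha, hb, hab, h⟩
  obtain ⟨h1, -⟩ := h 0
  simp only [Pi.zero_apply, PiLp.zero_apply, zero_sub, abs_neg] at h1
  have h2 : (a + b) / 2 ≤ a * Y₁ 0 + b * Y₂ 0 := by nlinarith [hY₁ 0, hY₂ 0]
  have h3 : a * Y₁ 0 + b * Y₂ 0 ≤ |a * Y₁ 0 + b * Y₂ 0| := le_abs_self _
  nlinarith

/-- **The parameters are controlled by the norm**: if `Y₁, Y₂ ≥ 1/2`, `κ ≤ 1/4` and `η` lies in
the cone with parameters `a, b`, then `a + b ≤ 4 η⁰_k ≤ 4‖η‖` for every `k`. [folklore] -/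
theorem param_le_of_mem (hY₁ : ∀ k, 1 / 2 ≤ Y₁ k) (hY₂ : ∀ k, 1 / 2 ≤ Y₂ k) (hκ : κ ≤ 1 / 4)
    {η : Fin n → SpaceTime 1} {a b : ℝ} (ha : 0 ≤ a) (hb : 0 ≤ b)
    (h : ∀ k, |η k 0 - (a * Y₁ k + b * Y₂ k)| < κ * (a + b) ∧ |η k 1| < κ * (a + b)) (k : Fin n) :
    a + b ≤ 4 * η k 0 ∧ a + b ≤ 4 * ‖η‖ := by
  obtain ⟨h1, -⟩ := h k
  have h2 : (a + b) / 2 ≤ a * Y₁ k + b * Y₂ k := by nlinarith [hY₁ k, hY₂ k]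
  have h3 := (abs_lt.1 h1).1
  have h4 : a + b ≤ 4 * η k 0 := by nlinarith
  refine ⟨h4, h4.trans ?_⟩
  have h5 : η k 0 ≤ ‖η‖ := ((le_abs_self _).trans (abs_apply_le_norm' (η k) 0)).trans
    (norm_le_pi_norm η k)
  linarith

/-- **The norm is controlled by the parameters**: if `|Y₁|, |Y₂| ≤ Yb` (`Yb ≥ 0`), `κ ≤ 1/2` and `η`
lies in the cone with parameters `a, b`, then `‖η‖ ≤ (a + b)(Yb + 1)`. [folklore] -/
theorem norm_le_of_mem {Yb : ℝ} (hYb : 0 ≤ Yb) (hY₁ : ∀ k, |Y₁ k| ≤ Yb) (hY₂ : ∀ k, |Y₂ k| ≤ Yb)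
    (hκ : κ ≤ 1 / 2) {η : Fin n → SpaceTime 1} {a b : ℝ} (ha : 0 ≤ a) (hb : 0 ≤ b)
    (h : ∀ k, |η k 0 - (a * Y₁ k + b * Y₂ k)| < κ * (a + b) ∧ |η k 1| < κ * (a + b)) :
    ‖η‖ ≤ (a + b) * (Yb + 1) := by
  refine (pi_norm_le_iff_of_nonneg (by positivity)).2 fun k => ?_
  obtain ⟨h1, h2⟩ := h k
  refine (norm_le_abs_add_abs (η k)).trans ?_
  have h3 : |η k 0| ≤ |a * Y₁ k + b * Y₂ k| + κ * (a + b) := by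
    have := abs_sub_abs_le_abs_sub (η k 0) (a * Y₁ k + b * Y₂ k)
    linarith
  have h4 : |a * Y₁ k + b * Y₂ k| ≤ (a + b) * Yb := by
    calc |a * Y₁ k + b * Y₂ k| ≤ |a * Y₁ k| + |b * Y₂ k| := abs_add_le _ _
      _ = a * |Y₁ k| + b * |Y₂ k| := by rw [abs_mul, abs_mul, abs_of_nonneg ha, abs_of_nonneg hb]
      _ ≤ a * Yb + b * Yb := by gcongr <;> simp [hY₁ k, hY₂ k]
      _ = (a + b) * Yb := by ring
  nlinarith

/-- The generating direction `Y e₀` (`Y = Y₁` with `a = 1, b = 0`, or `Y = Y₂` with `a = 0, b = 1`)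
lies in the cone when `κ > 0`. [folklore] -/
theorem smul_e₀_mem_twoGenCone_left (hκ : 0 < κ) :
    (fun k => Y₁ k • e₀ 1) ∈ twoGenCone Y₁ Y₂ κ := by
  refine ⟨1, 0, zero_le_one, le_rfl, by norm_num, fun k => ?_⟩
  simp [e₀_apply, hκ]

/-- The second generating direction lies in the cone when `κ > 0`. [folklore] -/
theorem smul_e₀_mem_twoGenCone_right (hκ : 0 < κ) :
    (fun k => Y₂ k • e₀ 1) ∈ twoGenCone Y₁ Y₂ κ := by
  refine ⟨0, 1, le_rfl, zero_le_one, by norm_num, fun k => ?_⟩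
  simp [e₀_apply, hκ]

end Cone

/-! ### Margins of boosted configurations from approximate imaginary times -/

/-- Successive differences of two sequences which are uniformly `e`-close are `2e`-close.
[folklore] -/
theorem abs_succDiff_sub_le {u v : Fin n → ℝ} {e : ℝ} (h : ∀ j, |u j - v j| ≤ e) (k : Fin n) :
    |succDiff u k - succDiff v k| ≤ 2 * e := by
  have he : 0 ≤ e := (abs_nonneg _).trans (h k)
  cases n with
  | zero => exact k.elim0
  | succ m =>
    refine Fin.cases ?_ (fun j => ?_) k
    · rw [succDiff_zero, succDiff_zero]
      linarith [h 0]
    · rw [succDiff_succ, succDiff_succ]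
      have h1 := h j.succ
      have h2 := h j.castSucc
      calc |u j.succ - u j.castSucc - (v j.succ - v j.castSucc)|
          = |(u j.succ - v j.succ) - (u j.castSucc - v j.castSucc)| := by ring_nf
        _ ≤ |u j.succ - v j.succ| + |u j.castSucc - v j.castSucc| := abs_sub _ _
        _ ≤ 2 * e := by linarith

/-- A coordinate of a successive difference is the successive difference of the coordinates.
[folklore] -/
theorem succDiff_apply_coord (Y : Fin n → SpaceTime 1) (k : Fin n) (μ : Fin 2) :
    succDiff Y k μ = succDiff (fun j => Y j μ) k :=
  (succDiff_map (fun v : SpaceTime 1 => v μ) (fun _ _ => rfl) Y k).symm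

/-- **Margins from approximate imaginary times.** If the time coordinates of `Y` are within `e`
of a sequence `A` whose successive differences are at least `g`, and the space coordinates of `Y`
are at most `e` in absolute value, then every successive difference of `Y` has margin at least
`g − 4e`. [folklore] -/
theorem coneMargin_succDiff_ge_of_approx {Y : Fin n → SpaceTime 1} {A : Fin n → ℝ} {e g : ℝ}
    (hT : ∀ k, |Y k 0 - A k| ≤ e) (hP : ∀ k, |Y k 1| ≤ e) (hA : ∀ k, g ≤ succDiff A k)
    (k : Fin n) : g - 4 * e ≤ coneMargin (succDiff Y k) := by
  rw [coneMargin_one, succDiff_apply_coord, succDiff_apply_coord]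
  have h1 := abs_succDiff_sub_le hT k
  have h2 : |succDiff (fun j => Y j 1) k - succDiff (fun _ : Fin n => (0 : ℝ)) k| ≤ 2 * e :=
    abs_succDiff_sub_le (u := fun j => Y j 1) (v := fun _ => 0) (fun j => by simpa using hP j) k
  have h0 : succDiff (fun _ : Fin n => (0 : ℝ)) k = 0 := by
    have : (fun _ : Fin n => (0 : ℝ)) = 0 := rfl
    rw [this, succDiff]; simp
  rw [h0, sub_zero] at h2
  have h3 := hA k
  have h4 := (abs_le.1 h1)
  linarith [le_abs_self (succDiff (fun j => Y j 0) k - succDiff A k),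
    neg_abs_le (succDiff (fun j => Y j 0) k - succDiff A k)]

/-! ### The ray form of a complex configuration -/

/-- **Ray form.** A complex configuration `B` whose imaginary parts have successive-difference
margins at least `κ₃ t` (`t > 0`), real parts of norm `≤ R` and imaginary parts of norm `≤ C t`
is `x' + i t η'` with `‖x'‖ ≤ R`, margins of `η'` at least `κ₃` and `‖η'‖ ≤ C`. [folklore] -/
theorem exists_ray_form {d : ℕ} {B : Fin n → Fin (d + 1) → ℂ} {t κ₃ R C : ℝ} (ht : 0 < t)
    (hR : 0 ≤ R) (hC : 0 ≤ C) (hmarg : ∀ k, κ₃ * t ≤ coneMargin (imPart (succDiff B k)))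
    (hre : ∀ k, ‖rePart (B k)‖ ≤ R) (him : ∀ k, ‖imPart (B k)‖ ≤ C * t) :
    ∃ x' η' : Fin n → SpaceTime d, ‖x'‖ ≤ R ∧ (∀ k, κ₃ ≤ coneMargin (succDiff η' k)) ∧ ‖η'‖ ≤ C ∧
      B = fun k => complexifyPoint (x' k) + ((t : ℂ) * I) • complexifyPoint (η' k) := by
  refine ⟨fun k => rePart (B k), t⁻¹ • fun k => imPart (B k), ?_, fun k => ?_, ?_, ?_⟩
  · exact (pi_norm_le_iff_of_nonneg hR).2 fun k => hre k
  · have h := hmarg k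
    have hsd : succDiff (fun k => imPart (B k)) k = imPart (succDiff B k) :=
      succDiff_map imPart imPart_sub B k
    rw [succDiff_smul, coneMargin_smul (inv_nonneg.2 ht.le), hsd, le_inv_mul_iff₀ ht, mul_comm]
    exact h
  · have hsm : ‖t⁻¹ • fun k => imPart (B k)‖ = t⁻¹ * ‖fun k => imPart (B k)‖ := by
      rw [norm_smul, norm_inv, Real.norm_eq_abs, abs_of_pos ht]
    rw [hsm, inv_mul_le_iff₀ ht]
    refine (pi_norm_le_iff_of_nonneg (by positivity)).2 fun k => ?_
    rw [mul_comm]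
    exact him k
  · funext k
    have h1 : (t⁻¹ • fun k => imPart (B k)) k = t⁻¹ • imPart (B k) := rfl
    rw [h1, ray_eq_add_I_smul, smul_smul, mul_inv_cancel₀ ht.ne', one_smul]
    exact (complexifyPoint_rePart_add_imPart (B k)).symm

/-! ### The data of the two-dimensional construction and its constants -/

/-- **Level data of a Euclidean configuration in `d = 1`.** Times `t` and positions `s` of `n`
points, bounded by `M ≥ 1`; a permutation `τ` along which the times are non-decreasing ("level
compatible") and a permutation `π` along which the points are sorted lexicographically (times, then
positions); and a gap `δ₀ ∈ (0, 1]` separating distinct times and separating the positions of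
distinct points with equal times. [folklore] -/
structure LevelData (n : ℕ) where
  /-- times [folklore] -/
  t : Fin n → ℝ
  /-- positions [folklore] -/
  s : Fin n → ℝ
  /-- a level-compatible order [folklore] -/
  τ : Equiv.Perm (Fin n)
  /-- the lexicographic order [folklore] -/
  π : Equiv.Perm (Fin n)
  /-- a bound for times and positions [folklore] -/
  M : ℝ
  /-- the gap [folklore] -/
  δ₀ : ℝ
  one_le_M : 1 ≤ M
  abs_t_le : ∀ k, |t k| ≤ M
  abs_s_le : ∀ k, |s k| ≤ M
  δ₀_pos : 0 < δ₀
  δ₀_le_one : δ₀ ≤ 1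
  t_τ_mono : ∀ k l, k ≤ l → t (τ k) ≤ t (τ l)
  t_π_mono : ∀ k l, k ≤ l → t (π k) ≤ t (π l)
  s_π_lt : ∀ k l, k < l → t (π k) = t (π l) → s (π k) < s (π l)
  gap_t : ∀ P Q, t P ≠ t Q → δ₀ ≤ |t P - t Q|
  gap_s : ∀ P Q, P ≠ Q → t P = t Q → δ₀ ≤ |s P - s Q|

namespace LevelData

variable (D : LevelData n)

/-- `N = 1/δ₀`. [folklore] -/
def N : ℝ := D.δ₀⁻¹
/-- `θ = 1/(4M)`, the slope of the second generator. [folklore] -/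
def θ : ℝ := (4 * D.M)⁻¹
/-- `θ'`, the within-level increment of the generators. [folklore] -/
def θ' : ℝ := D.δ₀ / (16 * D.M * D.N * ((n : ℝ) + 1) ^ 2)
/-- `κ = θ'/64`, the tolerance of the cone. [folklore] -/
def κ : ℝ := D.θ' / 64
/-- `Yb`, a bound for the generators. [folklore] -/
def Yb : ℝ := 2 * D.N * D.M + 3
/-- The first generator `Y₁ = N t + N M + 1 + θ' ρ_τ`. [folklore] -/
def Y₁ (P : Fin n) : ℝ := D.N * D.t P + D.N * D.M + 1 + D.θ' * ((D.τ.symm P : Fin n) : ℕ)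
/-- The second generator `Y₂ = Y₁ + θ s`. [folklore] -/
def Y₂ (P : Fin n) : ℝ := D.Y₁ P + D.θ * D.s P
/-- `δX`, the radius of the real base. [folklore] -/
def δX : ℝ := min (D.δ₀ / 8) (D.θ' / (64 * (D.θ' * ((n : ℝ) + 1) * D.N + D.θ + 1)))
/-- `γ`, the size of the local tube. [folklore] -/
def γ : ℝ := (8 * (D.θ' * ((n : ℝ) + 1) * D.N) + 8 * D.θ + 4)⁻¹
/-- The real base point `x₀ = (0, s)`. [folklore] -/
def x₀ : Fin n → SpaceTime 1 := fun P => EuclideanSpace.single 1 (D.s P)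
/-- The real base `O = B(x₀, δX)`. [folklore] -/
def O : Set (Fin n → SpaceTime 1) := Metric.ball D.x₀ D.δX
/-- The cone of imaginary parts. [folklore] -/
def Γ' : Set (Fin n → SpaceTime 1) := twoGenCone D.Y₁ D.Y₂ D.κ
/-- The margin constant `κ₃` of the keys. [folklore] -/
def κ₃ : ℝ := D.θ' / (4 * (D.Yb + 1))
/-- The bound `R'` on the real parts of the boosted points. [folklore] -/
def R' : ℝ := 2 * D.M + 4
/-- The bound `C₄` on the normalised imaginary parts of the boosted points. [folklore] -/
def C₄ : ℝ := 4 * (D.Yb + 3)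

/-! #### Inequalities between the constants -/

/-- `M > 0`. [folklore] -/
theorem M_pos : 0 < D.M := lt_of_lt_of_le one_pos D.one_le_M
/-- Auxiliary constant / inequality of the two-dimensional construction (`N_pos`). [folklore] -/
theorem N_pos : 0 < D.N := inv_pos.2 D.δ₀_pos
/-- Auxiliary constant / inequality of the two-dimensional construction (`N_mul_δ₀`). [folklore] -/
theorem N_mul_δ₀ : D.N * D.δ₀ = 1 := inv_mul_cancel₀ D.δ₀_pos.ne'
/-- Auxiliary constant / inequality of the two-dimensional construction (`one_le_N`). [folklore] -/
theorem one_le_N : 1 ≤ D.N := (one_le_inv₀ D.δ₀_pos).2 D.δ₀_le_one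
/-- Auxiliary constant / inequality of the two-dimensional construction (`θ_pos`). [folklore] -/
theorem θ_pos : 0 < D.θ := by have := D.M_pos; unfold θ; positivity
/-- Auxiliary constant / inequality of the two-dimensional construction (`θ_mul_M`). [folklore] -/
theorem θ_mul_M : D.θ * D.M = 1 / 4 := by
  have := D.M_pos; unfold θ; field_simp
/-- Auxiliary constant / inequality of the two-dimensional construction (`θ'_pos`). [folklore] -/
theorem θ'_pos : 0 < D.θ' := by
  have := D.M_pos; have := D.N_pos; have := D.δ₀_pos; unfold θ'; positivity
/-- `θ' (n+1)² M N · 16 = δ₀`. [folklore] -/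
theorem θ'_mul : D.θ' * (16 * D.M * D.N * ((n : ℝ) + 1) ^ 2) = D.δ₀ := by
  have := D.M_pos; have := D.N_pos; unfold θ'; field_simp
/-- `θ' (n + 1) N M ≤ 1/16`. [folklore] -/
theorem θ'_n_N_M_le : D.θ' * ((n : ℝ) + 1) * D.N * D.M ≤ 1 / 16 := by
  have h := D.θ'_mul
  have hM := D.M_pos; have hN := D.N_pos; have hθ' := D.θ'_pos
  have hn : (1 : ℝ) ≤ (n : ℝ) + 1 := by simp
  have h1 : D.θ' * ((n : ℝ) + 1) * D.N * D.M * 16 ≤ D.θ' * (16 * D.M * D.N * ((n : ℝ) + 1) ^ 2) := by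
    have : D.θ' * ((n : ℝ) + 1) * D.N * D.M * 16 = D.θ' * (16 * D.M * D.N * ((n : ℝ) + 1)) := by ring
    rw [this]
    gcongr
    nlinarith
  linarith [D.δ₀_le_one]
/-- `θ' n ≤ 1/16`. [folklore] -/
theorem θ'_n_le : D.θ' * n ≤ 1 / 16 := by
  have h := D.θ'_n_N_M_le
  have hθ' := D.θ'_pos
  have h1 : D.θ' * n ≤ D.θ' * ((n : ℝ) + 1) * D.N * D.M := by
    have h2 : D.θ' * n ≤ D.θ' * ((n : ℝ) + 1) := by nlinarith
    have h3 : D.θ' * ((n : ℝ) + 1) ≤ D.θ' * ((n : ℝ) + 1) * D.N :=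
      le_mul_of_one_le_right (by positivity) D.one_le_N
    have h4 : D.θ' * ((n : ℝ) + 1) * D.N ≤ D.θ' * ((n : ℝ) + 1) * D.N * D.M :=
      le_mul_of_one_le_right (by have := D.N_pos; positivity) D.one_le_M
    linarith
  linarith
/-- `θ' ≤ 1/16`. [folklore] -/
theorem θ'_le : D.θ' ≤ 1 / 16 := by
  have h := D.θ'_n_N_M_le
  have hθ' := D.θ'_pos
  have h3 : D.θ' ≤ D.θ' * ((n : ℝ) + 1) := le_mul_of_one_le_right hθ'.le (by simp)
  have h4 : D.θ' * ((n : ℝ) + 1) ≤ D.θ' * ((n : ℝ) + 1) * D.N :=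
    le_mul_of_one_le_right (by positivity) D.one_le_N
  have h5 : D.θ' * ((n : ℝ) + 1) * D.N ≤ D.θ' * ((n : ℝ) + 1) * D.N * D.M :=
    le_mul_of_one_le_right (by have := D.N_pos; positivity) D.one_le_M
  linarith
/-- `θ' n ≤ θ δ₀ / 4` (used for the direction of `π` in the base cone and the anchor). [folklore] -/
theorem θ'_n_le_θ_δ₀ : D.θ' * n ≤ D.θ * D.δ₀ / 4 := by
  -- `θ' n = δ₀ n / (16 M N (n+1)²) ≤ δ₀ /(16 M) = θ δ₀ / 4`
  have hM := D.M_pos; have hN := D.N_pos; have hδ := D.δ₀_pos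
  have hθM := D.θ_mul_M
  have h := D.θ'_mul
  have hn0 : (0 : ℝ) ≤ n := n.cast_nonneg
  -- multiply out
  have key : D.θ' * n * (16 * D.M) ≤ D.δ₀ := by
    have h1 : D.θ' * n * (16 * D.M) ≤ D.θ' * (16 * D.M * D.N * ((n : ℝ) + 1) ^ 2) := by
      have hθ' := D.θ'_pos
      have : (n : ℝ) * (16 * D.M) ≤ 16 * D.M * D.N * ((n : ℝ) + 1) ^ 2 := by
        have h2 : (n : ℝ) ≤ ((n : ℝ) + 1) ^ 2 := by nlinarith
        have h3 : (16 * D.M) * (n : ℝ) ≤ (16 * D.M) * ((n : ℝ) + 1) ^ 2 := by gcongr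
        have h4 : (16 * D.M) * ((n : ℝ) + 1) ^ 2 ≤ (16 * D.M) * ((n : ℝ) + 1) ^ 2 * D.N :=
          le_mul_of_one_le_right (by positivity) D.one_le_N
        linarith
      nlinarith
    linarith
  have hθeq : D.θ = (4 * D.M)⁻¹ := rfl
  rw [hθeq]
  rw [show (4 * D.M)⁻¹ * D.δ₀ / 4 = D.δ₀ / (16 * D.M) by field_simp; ring]
  rw [le_div_iff₀ (by positivity)]
  exact key
/-- Auxiliary constant / inequality of the two-dimensional construction (`κ_pos`). [folklore] -/
theorem κ_pos : 0 < D.κ := by have := D.θ'_pos; unfold κ; positivity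
/-- Auxiliary constant / inequality of the two-dimensional construction (`κ_eq`). [folklore] -/
theorem κ_eq : D.κ = D.θ' / 64 := rfl
/-- Auxiliary constant / inequality of the two-dimensional construction (`κ_le`). [folklore] -/
theorem κ_le : D.κ ≤ 1 / 4 := by have := D.θ'_le; unfold κ; linarith
/-- Auxiliary constant / inequality of the two-dimensional construction (`one_le_Yb`). [folklore] -/
theorem one_le_Yb : 1 ≤ D.Yb := by have := D.N_pos; have := D.M_pos; unfold Yb; nlinarith
/-- Auxiliary constant / inequality of the two-dimensional construction (`Yb_pos`). [folklore] -/
theorem Yb_pos : 0 < D.Yb := lt_of_lt_of_le one_pos D.one_le_Yb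
/-- The auxiliary rate `L = θ'(n+1)N + θ`. [folklore] -/
def L : ℝ := D.θ' * ((n : ℝ) + 1) * D.N + D.θ
/-- Auxiliary constant / inequality of the two-dimensional construction (`L_pos`). [folklore] -/
theorem L_pos : 0 < D.L := by
  have := D.θ'_pos; have := D.N_pos; have := D.θ_pos; unfold L; positivity
/-- Auxiliary constant / inequality of the two-dimensional construction (`δX_pos`). [folklore] -/
theorem δX_pos : 0 < D.δX := by
  have := D.δ₀_pos; have := D.θ'_pos; have := D.L_pos
  unfold δX; unfold L at *
  refine lt_min (by positivity) (by positivity)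
/-- Auxiliary constant / inequality of the two-dimensional construction (`δX_le_δ₀`). [folklore] -/
theorem δX_le_δ₀ : D.δX ≤ D.δ₀ / 8 := min_le_left _ _
/-- Auxiliary constant / inequality of the two-dimensional construction (`L_mul_δX_le`). [folklore] -/
theorem L_mul_δX_le : (D.L + 1) * D.δX ≤ D.θ' / 64 := by
  have hL := D.L_pos
  have h : D.δX ≤ D.θ' / (64 * (D.L + 1)) := min_le_right _ _
  rw [le_div_iff₀ (by positivity)] at h
  linarith
/-- Auxiliary constant / inequality of the two-dimensional construction (`δX_le_one`). [folklore] -/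
theorem δX_le_one : D.δX ≤ 1 := by
  have := D.δX_le_δ₀; have := D.δ₀_le_one; have := D.δ₀_pos; linarith
/-- Auxiliary constant / inequality of the two-dimensional construction (`γ_eq`). [folklore] -/
theorem γ_eq : D.γ = (8 * D.L + 4)⁻¹ := by unfold γ L; ring_nf
/-- Auxiliary constant / inequality of the two-dimensional construction (`γ_pos`). [folklore] -/
theorem γ_pos : 0 < D.γ := by
  rw [D.γ_eq]; have := D.L_pos; positivity
/-- Auxiliary constant / inequality of the two-dimensional construction (`γ_le`). [folklore] -/
theorem γ_le : D.γ ≤ 1 / 4 := by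
  rw [D.γ_eq]; have := D.L_pos
  rw [inv_le_comm₀ (by positivity) (by norm_num)]; linarith
/-- Auxiliary constant / inequality of the two-dimensional construction (`four_γ_L_le`). [folklore] -/
theorem four_γ_L_le : 4 * D.γ * D.L ≤ 1 / 2 := by
  rw [D.γ_eq]; have hL := D.L_pos
  rw [show 4 * (8 * D.L + 4)⁻¹ * D.L = (4 * D.L) / (8 * D.L + 4) by ring]
  rw [div_le_iff₀ (by positivity)]; linarith

/-! #### The generators -/

/-- Ranks along `τ` are `< n`. [folklore] -/
theorem rank_lt (P : Fin n) : (((D.τ.symm P : Fin n) : ℕ) : ℝ) < n := by exact_mod_cast (D.τ.symm P).isLt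
/-- Auxiliary constant / inequality of the two-dimensional construction (`rank_nonneg`). [folklore] -/
theorem rank_nonneg (P : Fin n) : (0 : ℝ) ≤ ((D.τ.symm P : Fin n) : ℕ) := Nat.cast_nonneg _

/-- Auxiliary constant / inequality of the two-dimensional construction (`one_le_Y₁`). [folklore] -/
theorem one_le_Y₁ (P : Fin n) : 1 ≤ D.Y₁ P := by
  have h1 : -D.M ≤ D.t P := (abs_le.1 (D.abs_t_le P)).1
  have h2 := D.rank_nonneg P
  have hN := D.N_pos; have hθ' := D.θ'_pos
  unfold Y₁; nlinarith
/-- Auxiliary constant / inequality of the two-dimensional construction (`Y₁_le`). [folklore] -/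
theorem Y₁_le (P : Fin n) : D.Y₁ P ≤ D.Yb - 1 := by
  have h1 : D.t P ≤ D.M := (abs_le.1 (D.abs_t_le P)).2
  have h2 := D.rank_lt P
  have h3 := D.θ'_n_le
  have hN := D.N_pos; have hθ' := D.θ'_pos
  unfold Y₁ Yb; nlinarith
/-- Auxiliary constant / inequality of the two-dimensional construction (`abs_θ_s_le`). [folklore] -/
theorem abs_θ_s_le (P : Fin n) : |D.θ * D.s P| ≤ 1 / 4 := by
  rw [abs_mul, abs_of_pos D.θ_pos]
  have := D.abs_s_le P; have := D.θ_mul_M; have := D.θ_pos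
  nlinarith
/-- Auxiliary constant / inequality of the two-dimensional construction (`half_le_Y₂`). [folklore] -/
theorem half_le_Y₂ (P : Fin n) : 1 / 2 ≤ D.Y₂ P := by
  have h1 := D.one_le_Y₁ P; have h2 := abs_le.1 (D.abs_θ_s_le P)
  unfold Y₂; linarith
/-- Auxiliary constant / inequality of the two-dimensional construction (`abs_Y₁_le`). [folklore] -/
theorem abs_Y₁_le (P : Fin n) : |D.Y₁ P| ≤ D.Yb := by
  rw [abs_of_pos (lt_of_lt_of_le one_pos (D.one_le_Y₁ P))]; linarith [D.Y₁_le P]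
/-- Auxiliary constant / inequality of the two-dimensional construction (`abs_Y₂_le`). [folklore] -/
theorem abs_Y₂_le (P : Fin n) : |D.Y₂ P| ≤ D.Yb := by
  have h1 := D.one_le_Y₁ P; have h1' := D.Y₁_le P; have h2 := abs_le.1 (D.abs_θ_s_le P)
  rw [abs_le]; unfold Y₂; constructor <;> linarith
/-- Auxiliary constant / inequality of the two-dimensional construction (`half_le_Y₁`). [folklore] -/
theorem half_le_Y₁ (P : Fin n) : 1 / 2 ≤ D.Y₁ P := by linarith [D.one_le_Y₁ P]

/-- Along `τ` the first generator increases by at least `θ'` at each step, and starts above `θ'`: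
`succDiff (Y₁ ∘ τ) ≥ θ'`. [folklore] -/
theorem θ'_le_succDiff_Y₁_τ (k : Fin n) : D.θ' ≤ succDiff (fun j => D.Y₁ (D.τ j)) k := by
  cases n with
  | zero => exact k.elim0
  | succ m =>
    refine Fin.cases ?_ (fun j => ?_) k
    · rw [succDiff_zero]
      linarith [D.one_le_Y₁ (D.τ 0), D.θ'_le]
    · rw [succDiff_succ]
      have ht := D.t_τ_mono j.castSucc j.succ (Fin.castSucc_lt_succ (i := j)).le
      have hN := D.N_pos
      unfold Y₁
      simp only [Equiv.symm_apply_apply, Fin.val_castSucc, Fin.val_succ, Nat.cast_add, Nat.cast_one]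
      nlinarith

/-- Along `π`, with `β = (a+b) θ' (n+1) N`, the sequence `(a+b) Y₁ ∘ π + β s ∘ π` increases by at
least `(a+b) θ'` at each step and starts above it (within a level the positions increase by at
least `δ₀`, across levels the times increase by at least `δ₀`). [folklore] -/
theorem θ'_le_succDiff_Aπ {c : ℝ} (hc : 0 ≤ c) (k : Fin n) :
    c * D.θ' ≤ succDiff (fun j => c * D.Y₁ (D.π j) +
      c * D.θ' * ((n : ℝ) + 1) * D.N * D.s (D.π j)) k := by
  have hN := D.N_pos; have hθ' := D.θ'_pos; have hθ'le := D.θ'_le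
  have hnNM := D.θ'_n_N_M_le; have hn := D.θ'_n_le
  have hM := D.one_le_M
  cases n with
  | zero => exact k.elim0
  | succ m =>
    refine Fin.cases ?_ (fun j => ?_) k
    · rw [succDiff_zero]
      have h1 := D.one_le_Y₁ (D.π 0)
      have h2 : -D.M ≤ D.s (D.π 0) := (abs_le.1 (D.abs_s_le _)).1
      -- `c Y₁ + β s ≥ c (1 - θ'(n+1) N M) ≥ c θ'`
      have h3 : c * D.θ' * ((((m + 1 : ℕ) : ℝ)) + 1) * D.N * D.s (D.π 0) ≥
          -(c * (D.θ' * ((((m + 1 : ℕ) : ℝ)) + 1) * D.N * D.M)) := by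
        have : 0 ≤ c * D.θ' * ((((m + 1 : ℕ) : ℝ)) + 1) * D.N := by positivity
        nlinarith
      nlinarith
    · rw [succDiff_succ]
      set P := D.π j.castSucc with hP
      set Q := D.π j.succ with hQ
      have hlt : j.castSucc < j.succ := Fin.castSucc_lt_succ (i := j)
      have htPQ : D.t P ≤ D.t Q := D.t_π_mono _ _ hlt.le
      have hrP := D.rank_lt P; have hrQ := D.rank_lt Q
      have hrP0 := D.rank_nonneg P; have hrQ0 := D.rank_nonneg Q
      have hsP := abs_le.1 (D.abs_s_le P); have hsQ := abs_le.1 (D.abs_s_le Q)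
      have hNδ := D.N_mul_δ₀
      by_cases heq : D.t P = D.t Q
      · -- same level: positions increase by at least `δ₀`
        have hs : D.s P < D.s Q := D.s_π_lt _ _ hlt heq
        have hPQ : P ≠ Q := fun h => by
          have := D.π.injective (hP.symm.trans (h.trans hQ))
          exact (Fin.castSucc_lt_succ (i := j)).ne this
        have hgap : D.δ₀ ≤ D.s Q - D.s P := by
          have := D.gap_s Q P hPQ.symm (heq.symm)
          rwa [abs_of_pos (sub_pos.2 hs)] at this
        unfold Y₁
        rw [heq]
        -- the rank term is at least `-θ' n`... bounded using ranks in `[0, n)`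
        have hmain : c * D.θ' * ((((m + 1 : ℕ) : ℝ)) + 1) * D.N * (D.s Q - D.s P) ≥
            c * D.θ' * ((((m + 1 : ℕ) : ℝ)) + 1) := by
          have h1 : D.N * (D.s Q - D.s P) ≥ 1 := by nlinarith
          have h0 : 0 ≤ c * D.θ' * ((((m + 1 : ℕ) : ℝ)) + 1) := by positivity
          nlinarith
        have hrank : c * (D.θ' * ((D.τ.symm Q : Fin (m + 1)) : ℕ)) - c * (D.θ' * ((D.τ.symm P : Fin (m+1)) : ℕ)) ≥
            -(c * D.θ' * (((m + 1 : ℕ) : ℝ))) := by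
          have h0 : 0 ≤ c * D.θ' := by positivity
          nlinarith
        nlinarith
      · -- different levels: times increase by at least `δ₀`
        have hlt' : D.t P < D.t Q := lt_of_le_of_ne htPQ heq
        have hgap : D.δ₀ ≤ D.t Q - D.t P := by
          have := D.gap_t Q P (Ne.symm heq)
          rwa [abs_of_pos (sub_pos.2 hlt')] at this
        unfold Y₁
        have h1 : D.N * (D.t Q - D.t P) ≥ 1 := by nlinarith
        have hrank : c * (D.θ' * ((D.τ.symm Q : Fin (m + 1)) : ℕ)) - c * (D.θ' * ((D.τ.symm P : Fin (m+1)) : ℕ)) ≥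
            -(c * D.θ' * (((m + 1 : ℕ) : ℝ))) := by
          have h0 : 0 ≤ c * D.θ' := by positivity
          nlinarith
        have hs : c * D.θ' * ((((m + 1 : ℕ) : ℝ)) + 1) * D.N * (D.s Q - D.s P) ≥
            -(2 * c * (D.θ' * ((((m + 1 : ℕ) : ℝ)) + 1) * D.N * D.M)) := by
          have h0 : 0 ≤ c * D.θ' * ((((m + 1 : ℕ) : ℝ)) + 1) * D.N := by positivity
          nlinarith
        nlinarith

/-! #### Points of the real base and of the cone -/

/-- Coordinates of a configuration of the real base `O = B(x₀, δX)`: times at most `δX`,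
positions within `δX` of `s`. [folklore] -/
theorem xr_bounds {xr : Fin n → SpaceTime 1} (hxr : xr ∈ D.O) (P : Fin n) :
    |xr P 0| ≤ D.δX ∧ |xr P 1 - D.s P| ≤ D.δX := by
  have h1 : dist (xr P) (D.x₀ P) ≤ dist xr D.x₀ := dist_le_pi_dist xr D.x₀ P
  have h2 : dist xr D.x₀ < D.δX := hxr
  have h3 : ‖xr P - D.x₀ P‖ ≤ D.δX := by rw [← dist_eq_norm]; linarith
  have h4 := (abs_apply_le_norm (xr P - D.x₀ P) 0).trans h3
  have h5 := (abs_apply_le_norm (xr P - D.x₀ P) 1).trans h3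
  have e0 : D.x₀ P 0 = 0 := by simp [x₀]
  have e1 : D.x₀ P 1 = D.s P := by simp [x₀]
  rw [PiLp.sub_apply, e0, sub_zero] at h4
  rw [PiLp.sub_apply, e1] at h5
  exact ⟨h4, h5⟩

/-- Norm bound for a configuration of the real base: `|xr P μ| ≤ M + 1`. [folklore] -/
theorem abs_xr_le {xr : Fin n → SpaceTime 1} (hxr : xr ∈ D.O) (P : Fin n) (μ : Fin 2) :
    |xr P μ| ≤ D.M + 1 := by
  obtain ⟨h0, h1⟩ := D.xr_bounds hxr P
  have hδ := D.δX_le_one; have hM := D.one_le_M; have hs := D.abs_s_le P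
  fin_cases μ
  · simp only [Fin.zero_eta]; linarith
  · simp only [Fin.mk_one]
    have := abs_sub_abs_le_abs_sub (xr P 1) (D.s P)
    linarith

/-- The parameters and the norm of a point of the cone `Γ'` of size `< γ`: `a + b ≤ 4‖η‖`,
`‖η‖ ≤ (a + b)(Yb + 1)`, `(a + b) L ≤ 1/2`, and the coordinates `|η P 1| ≤ κ (a + b)`,
`|η P 0 − (a Y₁ P + b Y₂ P)| ≤ κ (a + b)`. [folklore] -/
theorem cone_bounds {η : Fin n → SpaceTime 1} {a b : ℝ} (ha : 0 ≤ a) (hb : 0 ≤ b)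
    (h : ∀ k, |η k 0 - (a * D.Y₁ k + b * D.Y₂ k)| < D.κ * (a + b) ∧ |η k 1| < D.κ * (a + b))
    (hηγ : ‖η‖ < D.γ) (k : Fin n) :
    a + b ≤ 4 * ‖η‖ ∧ ‖η‖ ≤ (a + b) * (D.Yb + 1) ∧ (a + b) * D.L ≤ 1 / 2 := by
  have h1 := (param_le_of_mem D.half_le_Y₁ D.half_le_Y₂ D.κ_le ha hb h k).2
  have h2 := norm_le_of_mem D.Yb_pos.le D.abs_Y₁_le D.abs_Y₂_le (by linarith [D.κ_le]) ha hb h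
  refine ⟨h1, h2, ?_⟩
  have h3 := D.four_γ_L_le; have hL := D.L_pos
  nlinarith

/-! #### The keys: margins of the boosted permuted points -/

end LevelData

/-- **Margins, real parts and imaginary parts of a boosted permuted point from approximate
imaginary times.** Let `B = B₀(iφ)((xr + iη) ∘ σ)` with `cos φ = c₀ ∈ [1/2, 1]`, `sin φ = v`,
`|v| ≤ 1`. If the boosted imaginary times `c₀ η⁰ + v xr¹` (along `σ`) are within `e` of a sequence
`A` with `succDiff A ≥ g`, the boosted imaginary positions `c₀ η¹ + v xr⁰` are at most `e`, then all
margins of `B` are at least `g − 4e`; moreover `‖Re B_k‖ ≤ 2 Rx + 2` and `‖Im B_k‖ ≤ |A_k| + 2e`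
when `|xr| ≤ Rx` and `|η| ≤ 1` coordinatewise. [folklore] -/
theorem boost_estimates_of_approx {xr η : Fin n → SpaceTime 1} (σ : Equiv.Perm (Fin n))
    {φ c₀ v : ℝ} (hcos : Real.cos φ = c₀) (hsin : Real.sin φ = v) (hc0 : 0 ≤ c₀) (hc1 : c₀ ≤ 1)
    (hv : |v| ≤ 1) {A : Fin n → ℝ} {e g Rx : ℝ}
    (hT : ∀ k, |c₀ * η (σ k) 0 + v * xr (σ k) 1 - A k| ≤ e)
    (hP : ∀ k, |c₀ * η (σ k) 1 + v * xr (σ k) 0| ≤ e) (hA : ∀ k, g ≤ succDiff A k)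
    (hxr : ∀ P (μ : Fin 2), |xr P μ| ≤ Rx) (hη1 : ∀ P (μ : Fin 2), |η P μ| ≤ 1) :
    (∀ k, g - 4 * e ≤ coneMargin (imPart (succDiff
        (boostConfig n 0 ((φ : ℂ) * I) (fun k => rayC xr η I (σ k))) k))) ∧
    (∀ k, ‖rePart (boostConfig n 0 ((φ : ℂ) * I) (fun k => rayC xr η I (σ k)) k)‖ ≤ 2 * Rx + 2) ∧
    (∀ k, ‖imPart (boostConfig n 0 ((φ : ℂ) * I) (fun k => rayC xr η I (σ k)) k)‖ ≤
        |A k| + 2 * e) := by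
  set B := boostConfig n 0 ((φ : ℂ) * I) (fun k => rayC xr η I (σ k)) with hB
  have hIm0 : ∀ k, imPart (B k) 0 = c₀ * η (σ k) 0 + v * xr (σ k) 1 := fun k => by
    rw [hB, boostConfig_apply, rayC_apply, imPart_boost_apply_zero, hcos, hsin]
  have hIm1 : ∀ k, imPart (B k) 1 = c₀ * η (σ k) 1 + v * xr (σ k) 0 := fun k => by
    rw [hB, boostConfig_apply, rayC_apply, imPart_boost_apply_one, hcos, hsin]
  have hRe0 : ∀ k, rePart (B k) 0 = c₀ * xr (σ k) 0 - v * η (σ k) 1 := fun k => by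
    rw [hB, boostConfig_apply, rayC_apply, rePart_boost_apply_zero, hcos, hsin]
  have hRe1 : ∀ k, rePart (B k) 1 = c₀ * xr (σ k) 1 - v * η (σ k) 0 := fun k => by
    rw [hB, boostConfig_apply, rayC_apply, rePart_boost_apply_one, hcos, hsin]
  have hT' : ∀ k, |imPart (B k) 0 - A k| ≤ e := fun k => by rw [hIm0]; exact hT k
  have hP' : ∀ k, |imPart (B k) 1| ≤ e := fun k => by rw [hIm1]; exact hP k
  have hmargin := fun k => coneMargin_succDiff_ge_of_approx hT' hP' hA k
  refine ⟨fun k => ?_, fun k => ?_, fun k => ?_⟩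
  · have hsd : imPart (succDiff B k) = succDiff (fun j => imPart (B j)) k :=
      (succDiff_map imPart imPart_sub B k).symm
    rw [hsd]
    exact hmargin k
  · refine (norm_le_abs_add_abs _).trans ?_
    rw [hRe0, hRe1]
    have hv0 : 0 ≤ |v| := abs_nonneg v
    have key : ∀ p q : ℝ, |p| ≤ Rx → |q| ≤ 1 → |c₀ * p - v * q| ≤ Rx + 1 := by
      intro p q hp hq
      refine (abs_sub _ _).trans ?_
      rw [abs_mul, abs_mul, abs_of_nonneg hc0]
      have h1 : c₀ * |p| ≤ |p| := mul_le_of_le_one_left (abs_nonneg _) hc1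
      have h2 : |v| * |q| ≤ |q| := mul_le_of_le_one_left (abs_nonneg _) hv
      linarith
    have h1 := key _ _ (hxr (σ k) 0) (hη1 (σ k) 1)
    have h2 := key _ _ (hxr (σ k) 1) (hη1 (σ k) 0)
    linarith
  · refine (norm_le_abs_add_abs _).trans ?_
    have h1 : |imPart (B k) 0| ≤ |A k| + e := by
      have := hT' k
      have := abs_sub_abs_le_abs_sub (imPart (B k) 0) (A k)
      linarith
    have h2 := hP' k
    linarith

namespace LevelData

variable (D : LevelData n)

/-- Slopes are at most `1/2` on the cone of size `< γ`: `bθ ≤ (a+b)θ ≤ 1/2` and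
`(a+b) θ' (n+1) N ≤ 1/2`. [folklore] -/
theorem slopes_le {a b : ℝ} (ha : 0 ≤ a) (hb : 0 ≤ b) (hL : (a + b) * D.L ≤ 1 / 2) :
    b * D.θ ≤ 1 / 2 ∧ (a + b) * D.θ ≤ 1 / 2 ∧ (a + b) * D.θ' * ((n : ℝ) + 1) * D.N ≤ 1 / 2 := by
  have hθ := D.θ_pos; have hθ' := D.θ'_pos; have hN := D.N_pos
  have hLdef : D.L = D.θ' * ((n : ℝ) + 1) * D.N + D.θ := rfl
  have h1 : 0 ≤ (a + b) * (D.θ' * ((n : ℝ) + 1) * D.N) := by positivity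
  have h1' : 0 ≤ (a + b) * D.θ := by positivity
  have h2 : b * D.θ ≤ (a + b) * D.θ := by nlinarith
  have h3 : (a + b) * D.L = (a + b) * (D.θ' * ((n : ℝ) + 1) * D.N) + (a + b) * D.θ := by
    rw [hLdef]; ring
  refine ⟨by linarith, by linarith, ?_⟩
  have : (a + b) * D.θ' * ((n : ℝ) + 1) * D.N = (a + b) * (D.θ' * ((n : ℝ) + 1) * D.N) := by ring
  linarith

/-- `θ δX ≤ θ'/64` and `(θ'(n+1)N + θ) δX ≤ θ'/64`. [folklore] -/
theorem rates_mul_δX_le : D.θ * D.δX ≤ D.θ' / 64 ∧ D.L * D.δX ≤ D.θ' / 64 := by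
  have h := D.L_mul_δX_le
  have hδX := D.δX_pos; have hL := D.L_pos; have hθ' := D.θ'_pos; have hN := D.N_pos
  have hLdef : D.L = D.θ' * ((n : ℝ) + 1) * D.N + D.θ := rfl
  have h1 : D.θ ≤ D.L := by
    rw [hLdef]; have : 0 ≤ D.θ' * ((n : ℝ) + 1) * D.N := by positivity
    linarith
  have h2 : D.θ * D.δX ≤ D.L * D.δX := mul_le_mul_of_nonneg_right h1 hδX.le
  have h3 : D.L * D.δX ≤ (D.L + 1) * D.δX := by nlinarith
  exact ⟨by linarith, by linarith⟩

/-- **The margin arithmetic**: with an error rate `r ≤ θ'/32` (`e = (a+b) r`), a gap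
`g ≥ c₀ (a+b) θ'` with `c₀ ≥ 1/2`, and `‖η‖ ≤ (a+b)(Yb+1)`, one has `κ₃ ‖η‖ ≤ g − 4e`. [folklore] -/
theorem κ₃_mul_le {a b c₀ r g nrm : ℝ} (hab : 0 < a + b) (hc0 : 1 / 2 ≤ c₀)
    (hr : r ≤ D.θ' / 32) (hg : c₀ * (a + b) * D.θ' ≤ g) (hnrm : nrm ≤ (a + b) * (D.Yb + 1)) :
    D.κ₃ * nrm ≤ g - 4 * ((a + b) * r) := by
  have hθ' := D.θ'_pos; have hYb := D.Yb_pos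
  have h1 : 4 * ((a + b) * r) ≤ (a + b) * D.θ' / 8 := by
    have := mul_le_mul_of_nonneg_left hr hab.le
    linarith
  have h2 : D.κ₃ * nrm ≤ (a + b) * D.θ' / 4 := by
    have h3 : D.κ₃ * nrm ≤ D.κ₃ * ((a + b) * (D.Yb + 1)) :=
      mul_le_mul_of_nonneg_left hnrm (by unfold κ₃; positivity)
    have h4 : D.κ₃ * ((a + b) * (D.Yb + 1)) = (a + b) * D.θ' / 4 := by
      unfold κ₃; field_simp
    linarith
  have h0 : 0 ≤ (a + b) * D.θ' := by positivity
  have h3 : (a + b) * D.θ' / 2 ≤ c₀ * (a + b) * D.θ' := by nlinarith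
  linarith

/-- **The norm arithmetic**: `|A| + 2e ≤ C₄ ‖η‖` when `|A| ≤ (a+b)(Yb+1)`, `e ≤ (a+b)` and
`a + b ≤ 4‖η‖`. [folklore] -/
theorem abs_add_le_C₄_mul {a b Ak e nrm : ℝ} (hA : |Ak| ≤ (a + b) * (D.Yb + 1)) (he : e ≤ a + b)
    (hsum : a + b ≤ 4 * nrm) : |Ak| + 2 * e ≤ D.C₄ * nrm := by
  have hYb := D.Yb_pos
  have h3 : (a + b) * (D.Yb + 3) ≤ 4 * nrm * (D.Yb + 3) :=
    mul_le_mul_of_nonneg_right hsum (by positivity)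
  unfold C₄
  nlinarith

/-- Coordinates of `η` of size `< γ` are at most `1`. [folklore] -/
theorem abs_η_le {η : Fin n → SpaceTime 1} (hηγ : ‖η‖ < D.γ) (P : Fin n) (μ : Fin 2) :
    |η P μ| ≤ 1 :=
  ((abs_apply_le_norm (η P) μ).trans (norm_le_pi_norm η P)).trans (by linarith [D.γ_le])

/-- **The key for `τ`.** For `xr` in the real base and `η` in the cone of size `< γ` with
parameters `a, b`, the imaginary boost by the angle `φ = −arctan(bθ)` takes `(xr + iη) ∘ τ` to a
configuration whose imaginary parts have all successive-difference margins at least `κ₃ ‖η‖`, with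
real parts of norm `≤ R'` and imaginary parts of norm `≤ C₄ ‖η‖` (the slope `−bθ` cancels the
position term `bθ s` of the imaginary times exactly; along `τ` the generator `Y₁` increases by
`θ'` at each step). [folklore] -/
theorem key_τ {xr η : Fin n → SpaceTime 1} (hxr : xr ∈ D.O) (hη : η ∈ D.Γ') (hηγ : ‖η‖ < D.γ) :
    ∃ φ : ℝ,
      (∀ k, D.κ₃ * ‖η‖ ≤ coneMargin (imPart (succDiff
        (boostConfig n 0 ((φ : ℂ) * I) (fun k => rayC xr η I (D.τ k))) k))) ∧
      (∀ k, ‖rePart (boostConfig n 0 ((φ : ℂ) * I) (fun k => rayC xr η I (D.τ k)) k)‖ ≤ D.R') ∧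
      (∀ k, ‖imPart (boostConfig n 0 ((φ : ℂ) * I) (fun k => rayC xr η I (D.τ k)) k)‖ ≤
        D.C₄ * ‖η‖) := by
  rcases Nat.eq_zero_or_pos n with hn | hn
  · subst hn
    exact ⟨0, fun k => k.elim0, fun k => k.elim0, fun k => k.elim0⟩
  obtain ⟨a, b, ha, hb, hab, h⟩ := hη
  obtain ⟨hsum, hηle, hL⟩ := D.cone_bounds ha hb h hηγ ⟨0, hn⟩
  have hθ := D.θ_pos; have hθ' := D.θ'_pos; have hκ := D.κ_pos; have hδX := D.δX_pos
  obtain ⟨hbθ1, -, -⟩ := D.slopes_le ha hb hL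
  obtain ⟨hθδ, -⟩ := D.rates_mul_δX_le
  -- the slope `u = bθ ≤ 1/2` and the angle
  set u : ℝ := b * D.θ with hu
  have hu0 : 0 ≤ u := by positivity
  have huabs : |u| ≤ 1 := by rw [abs_of_nonneg hu0]; linarith
  obtain ⟨hc0, hc1, hsin, -⟩ := cos_arctan_ge_half huabs
  set c₀ := Real.cos (Real.arctan u) with hc₀
  have hc0' : (0 : ℝ) ≤ c₀ := by linarith
  set φ : ℝ := -Real.arctan u with hφ
  have hcosφ : Real.cos φ = c₀ := by rw [hφ, Real.cos_neg]
  have hsinφ : Real.sin φ = -(u * c₀) := by rw [hφ, Real.sin_neg, hsin]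
  have huc : u * c₀ ≤ 1 := by
    have := mul_le_mul hbθ1 hc1 hc0' (by norm_num : (0 : ℝ) ≤ 1 / 2)
    linarith
  have hvabs : |-(u * c₀)| ≤ 1 := by rwa [abs_neg, abs_of_nonneg (mul_nonneg hu0 hc0')]
  -- the target sequence and the error
  set A : Fin n → ℝ := fun k => c₀ * (a + b) * D.Y₁ (D.τ k) with hA
  set r : ℝ := D.κ + D.θ * D.δX with hr
  have hbθ : 0 ≤ b * D.θ := by positivity
  have hbe : D.κ * (a + b) + b * D.θ * D.δX ≤ (a + b) * r := by
    have : 0 ≤ a * (D.θ * D.δX) := by positivity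
    rw [hr]; nlinarith
  have hT : ∀ k, |c₀ * η (D.τ k) 0 + -(u * c₀) * xr (D.τ k) 1 - A k| ≤ (a + b) * r := by
    intro k
    obtain ⟨-, hx1⟩ := D.xr_bounds hxr (D.τ k)
    have h0 := (h (D.τ k)).1
    have hY₂ : D.Y₂ (D.τ k) = D.Y₁ (D.τ k) + D.θ * D.s (D.τ k) := rfl
    have heq : c₀ * η (D.τ k) 0 + -(u * c₀) * xr (D.τ k) 1 - A k =
        c₀ * ((η (D.τ k) 0 - (a * D.Y₁ (D.τ k) + b * D.Y₂ (D.τ k))) -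
          b * D.θ * (xr (D.τ k) 1 - D.s (D.τ k))) := by
      rw [hA, hY₂, hu]; ring
    rw [heq, abs_mul, abs_of_nonneg hc0']
    have h1 : |η (D.τ k) 0 - (a * D.Y₁ (D.τ k) + b * D.Y₂ (D.τ k)) -
        b * D.θ * (xr (D.τ k) 1 - D.s (D.τ k))| ≤ D.κ * (a + b) + b * D.θ * D.δX := by
      refine (abs_sub _ _).trans ?_
      rw [abs_mul, abs_of_nonneg hbθ]
      have := mul_le_mul_of_nonneg_left hx1 hbθ
      linarith
    calc c₀ * _ ≤ 1 * (D.κ * (a + b) + b * D.θ * D.δX) := by gcongr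
      _ ≤ (a + b) * r := by linarith
  have hP : ∀ k, |c₀ * η (D.τ k) 1 + -(u * c₀) * xr (D.τ k) 0| ≤ (a + b) * r := by
    intro k
    obtain ⟨hx0, -⟩ := D.xr_bounds hxr (D.τ k)
    have h1 := (h (D.τ k)).2
    have heq : c₀ * η (D.τ k) 1 + -(u * c₀) * xr (D.τ k) 0 =
        c₀ * (η (D.τ k) 1 - u * xr (D.τ k) 0) := by ring
    rw [heq, abs_mul, abs_of_nonneg hc0']
    have h2 : |η (D.τ k) 1 - u * xr (D.τ k) 0| ≤ D.κ * (a + b) + b * D.θ * D.δX := by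
      refine (abs_sub _ _).trans ?_
      rw [abs_mul, abs_of_nonneg hu0, hu]
      have := mul_le_mul_of_nonneg_left hx0 hbθ
      linarith
    calc c₀ * _ ≤ 1 * (D.κ * (a + b) + b * D.θ * D.δX) := by gcongr
      _ ≤ (a + b) * r := by linarith
  have hAgap : ∀ k, c₀ * (a + b) * D.θ' ≤ succDiff A k := by
    intro k
    have h1 := D.θ'_le_succDiff_Y₁_τ k
    have heq : succDiff A k = c₀ * (a + b) * succDiff (fun j => D.Y₁ (D.τ j)) k := by
      rw [hA]
      exact succDiff_map (fun r : ℝ => c₀ * (a + b) * r) (fun x y => by ring) _ k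
    rw [heq]
    exact mul_le_mul_of_nonneg_left h1 (by positivity)
  obtain ⟨hm, hre, him⟩ := boost_estimates_of_approx (D.τ) hcosφ hsinφ hc0' hc1 hvabs hT hP hAgap
    (fun P μ => D.abs_xr_le hxr P μ) (fun P μ => D.abs_η_le hηγ P μ)
  -- the arithmetic of the constants
  have hr32 : r ≤ D.θ' / 32 := by rw [hr, D.κ_eq]; linarith
  have hgap := D.κ₃_mul_le hab hc0 hr32 le_rfl hηle
  have he1 : (a + b) * r ≤ a + b := by
    have : r ≤ 1 := by have := D.θ'_le; linarith
    exact mul_le_of_le_one_right hab.le this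
  have hAk : ∀ k, |A k| ≤ (a + b) * (D.Yb + 1) := by
    intro k
    have hY := D.one_le_Y₁ (D.τ k)
    have hY' := D.Y₁_le (D.τ k)
    have hAk0 : 0 ≤ c₀ * (a + b) * D.Y₁ (D.τ k) :=
      mul_nonneg (mul_nonneg hc0' hab.le) (by linarith)
    show |c₀ * (a + b) * D.Y₁ (D.τ k)| ≤ _
    rw [abs_of_nonneg hAk0]
    have h5 : c₀ * (a + b) ≤ a + b := mul_le_of_le_one_left hab.le hc1
    have h6 : c₀ * (a + b) * D.Y₁ (D.τ k) ≤ (a + b) * D.Y₁ (D.τ k) :=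
      mul_le_mul_of_nonneg_right h5 (by linarith)
    have h7 : (a + b) * D.Y₁ (D.τ k) ≤ (a + b) * (D.Yb + 1) :=
      mul_le_mul_of_nonneg_left (by linarith) hab.le
    linarith
  refine ⟨φ, fun k => hgap.trans (hm k), fun k => (hre k).trans ?_,
    fun k => (him k).trans (D.abs_add_le_C₄_mul (hAk k) he1 hsum)⟩
  unfold R'; linarith

/-- **The key for `π`.** For `xr` in the real base and `η` in the cone of size `< γ` with
parameters `a, b`, the imaginary boost by the angle `φ = arctan(β − bθ)`, `β = (a+b) θ' (n+1) N`,
takes `(xr + iη) ∘ π` to a configuration with margins at least `κ₃ ‖η‖`, real parts of norm `≤ R'`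
and imaginary parts of norm `≤ C₄ ‖η‖` (the slope turns the position term of the imaginary times
into `β s`, increasing along `π` within the levels, which dominates the disorder `θ' ρ_τ` of the
generator there; across levels the generator jumps by at least `1`). [folklore] -/
theorem key_π {xr η : Fin n → SpaceTime 1} (hxr : xr ∈ D.O) (hη : η ∈ D.Γ') (hηγ : ‖η‖ < D.γ) :
    ∃ φ : ℝ,
      (∀ k, D.κ₃ * ‖η‖ ≤ coneMargin (imPart (succDiff
        (boostConfig n 0 ((φ : ℂ) * I) (fun k => rayC xr η I (D.π k))) k))) ∧
      (∀ k, ‖rePart (boostConfig n 0 ((φ : ℂ) * I) (fun k => rayC xr η I (D.π k)) k)‖ ≤ D.R') ∧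
      (∀ k, ‖imPart (boostConfig n 0 ((φ : ℂ) * I) (fun k => rayC xr η I (D.π k)) k)‖ ≤
        D.C₄ * ‖η‖) := by
  rcases Nat.eq_zero_or_pos n with hn | hn
  · subst hn
    exact ⟨0, fun k => k.elim0, fun k => k.elim0, fun k => k.elim0⟩
  obtain ⟨a, b, ha, hb, hab, h⟩ := hη
  obtain ⟨hsum, hηle, hL⟩ := D.cone_bounds ha hb h hηγ ⟨0, hn⟩
  have hθ := D.θ_pos; have hθ' := D.θ'_pos; have hκ := D.κ_pos; have hδX := D.δX_pos
  have hN := D.N_pos; have hM := D.M_pos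
  obtain ⟨hbθ1, -, hβ1⟩ := D.slopes_le ha hb hL
  obtain ⟨-, hLδ⟩ := D.rates_mul_δX_le
  have hLdef : D.L = D.θ' * ((n : ℝ) + 1) * D.N + D.θ := rfl
  -- the slope `u = β − bθ`, `|u| ≤ 1/2`, and the angle
  set β : ℝ := (a + b) * D.θ' * ((n : ℝ) + 1) * D.N with hβ
  have hβ0 : 0 ≤ β := by positivity
  set u : ℝ := β - b * D.θ with hu
  have hbθ : 0 ≤ b * D.θ := by positivity
  have huabs' : |u| ≤ 1 / 2 := by
    rw [abs_le]; constructor <;> linarith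
  have huabs : |u| ≤ 1 := by linarith
  have huL : |u| ≤ (a + b) * D.L := by
    have h1 : (a + b) * D.L = β + (a + b) * D.θ := by rw [hLdef, hβ]; ring
    rw [h1, abs_le]
    constructor <;> nlinarith
  obtain ⟨hc0, hc1, hsin, hsinle⟩ := cos_arctan_ge_half huabs
  set c₀ := Real.cos (Real.arctan u) with hc₀
  have hc0' : (0 : ℝ) ≤ c₀ := by linarith
  set φ : ℝ := Real.arctan u with hφ
  have hvabs : |u * c₀| ≤ 1 := by rw [← hsin]; exact hsinle.trans huabs
  -- the target sequence and the error
  set A : Fin n → ℝ := fun k => c₀ * ((a + b) * D.Y₁ (D.π k) + β * D.s (D.π k)) with hA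
  set r : ℝ := D.κ + D.L * D.δX with hr
  have hbe : D.κ * (a + b) + |u| * D.δX ≤ (a + b) * r := by
    have := mul_le_mul_of_nonneg_right huL hδX.le
    rw [hr]; nlinarith
  have hT : ∀ k, |c₀ * η (D.π k) 0 + u * c₀ * xr (D.π k) 1 - A k| ≤ (a + b) * r := by
    intro k
    obtain ⟨-, hx1⟩ := D.xr_bounds hxr (D.π k)
    have h0 := (h (D.π k)).1
    have hY₂ : D.Y₂ (D.π k) = D.Y₁ (D.π k) + D.θ * D.s (D.π k) := rfl
    have heq : c₀ * η (D.π k) 0 + u * c₀ * xr (D.π k) 1 - A k =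
        c₀ * ((η (D.π k) 0 - (a * D.Y₁ (D.π k) + b * D.Y₂ (D.π k))) +
          u * (xr (D.π k) 1 - D.s (D.π k))) := by
      rw [hA, hY₂, hu, hβ]; ring
    rw [heq, abs_mul, abs_of_nonneg hc0']
    have h1 : |η (D.π k) 0 - (a * D.Y₁ (D.π k) + b * D.Y₂ (D.π k)) +
        u * (xr (D.π k) 1 - D.s (D.π k))| ≤ D.κ * (a + b) + |u| * D.δX := by
      refine (abs_add_le _ _).trans ?_
      rw [abs_mul]
      have := mul_le_mul_of_nonneg_left hx1 (abs_nonneg u)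
      linarith
    calc c₀ * _ ≤ 1 * (D.κ * (a + b) + |u| * D.δX) := by gcongr
      _ ≤ (a + b) * r := by linarith
  have hP : ∀ k, |c₀ * η (D.π k) 1 + u * c₀ * xr (D.π k) 0| ≤ (a + b) * r := by
    intro k
    obtain ⟨hx0, -⟩ := D.xr_bounds hxr (D.π k)
    have h1 := (h (D.π k)).2
    have heq : c₀ * η (D.π k) 1 + u * c₀ * xr (D.π k) 0 =
        c₀ * (η (D.π k) 1 + u * xr (D.π k) 0) := by ring
    rw [heq, abs_mul, abs_of_nonneg hc0']
    have h2 : |η (D.π k) 1 + u * xr (D.π k) 0| ≤ D.κ * (a + b) + |u| * D.δX := by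
      refine (abs_add_le _ _).trans ?_
      rw [abs_mul]
      have := mul_le_mul_of_nonneg_left hx0 (abs_nonneg u)
      linarith
    calc c₀ * _ ≤ 1 * (D.κ * (a + b) + |u| * D.δX) := by gcongr
      _ ≤ (a + b) * r := by linarith
  have hAgap : ∀ k, c₀ * (a + b) * D.θ' ≤ succDiff A k := by
    intro k
    have h1 := D.θ'_le_succDiff_Aπ hab.le k
    have heq : succDiff A k = c₀ * succDiff (fun j => (a + b) * D.Y₁ (D.π j) +
        (a + b) * D.θ' * ((n : ℝ) + 1) * D.N * D.s (D.π j)) k := by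
      rw [hA, hβ]
      exact succDiff_map (fun r : ℝ => c₀ * r) (fun x y => by ring) _ k
    rw [heq, mul_assoc]
    exact mul_le_mul_of_nonneg_left h1 hc0'
  obtain ⟨hm, hre, him⟩ := boost_estimates_of_approx (D.π) rfl hsin hc0' hc1 hvabs hT hP hAgap
    (fun P μ => D.abs_xr_le hxr P μ) (fun P μ => D.abs_η_le hηγ P μ)
  -- the arithmetic of the constants
  have hr32 : r ≤ D.θ' / 32 := by rw [hr, D.κ_eq]; linarith
  have hgap := D.κ₃_mul_le hab hc0 hr32 le_rfl hηle
  have he1 : (a + b) * r ≤ a + b := by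
    have : r ≤ 1 := by have := D.θ'_le; linarith
    exact mul_le_of_le_one_right hab.le this
  have hAk : ∀ k, |A k| ≤ (a + b) * (D.Yb + 1) := by
    intro k
    have hY := D.abs_Y₁_le (D.π k)
    have hs := D.abs_s_le (D.π k)
    have hnNM := D.θ'_n_N_M_le
    show |c₀ * ((a + b) * D.Y₁ (D.π k) + β * D.s (D.π k))| ≤ _
    rw [abs_mul, abs_of_nonneg hc0']
    have h1 : |(a + b) * D.Y₁ (D.π k) + β * D.s (D.π k)| ≤ (a + b) * D.Yb + β * D.M := by
      refine (abs_add_le _ _).trans ?_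
      rw [abs_mul, abs_mul, abs_of_nonneg hab.le, abs_of_nonneg hβ0]
      have := mul_le_mul_of_nonneg_left hY hab.le
      have := mul_le_mul_of_nonneg_left hs hβ0
      linarith
    have h2 : β * D.M ≤ (a + b) * 1 := by
      rw [hβ]
      have : (a + b) * D.θ' * ((n : ℝ) + 1) * D.N * D.M = (a + b) * (D.θ' * ((n : ℝ) + 1) * D.N * D.M) := by
        ring
      rw [this]
      exact mul_le_mul_of_nonneg_left (by linarith) hab.le
    calc c₀ * _ ≤ 1 * ((a + b) * D.Yb + β * D.M) := by gcongr
      _ ≤ (a + b) * (D.Yb + 1) := by linarith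
  refine ⟨φ, fun k => hgap.trans (hm k), fun k => (hre k).trans ?_,
    fun k => (him k).trans (D.abs_add_le_C₄_mul (hAk k) he1 hsum)⟩
  unfold R'; linarith

/-! #### The ray directions -/

/-- The ray direction of `τ`: `η_τ = Y₁ e₀`. [folklore] -/
def ητ : Fin n → SpaceTime 1 := fun P => D.Y₁ P • e₀ 1
/-- The ray direction of `π`: `η_π = Y₂ e₀`. [folklore] -/
def ηπ : Fin n → SpaceTime 1 := fun P => D.Y₂ P • e₀ 1

/-- Auxiliary constant / inequality of the two-dimensional construction (`ητ_mem`). [folklore] -/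
theorem ητ_mem : D.ητ ∈ D.Γ' := smul_e₀_mem_twoGenCone_left D.κ_pos
/-- Auxiliary constant / inequality of the two-dimensional construction (`ηπ_mem`). [folklore] -/
theorem ηπ_mem : D.ηπ ∈ D.Γ' := smul_e₀_mem_twoGenCone_right D.κ_pos

/-- A configuration of positive multiples `c_k e₀` with `succDiff c > 0` lies in the base cone.
[folklore] -/
theorem smul_e₀_mem_tubeCone {c : Fin n → ℝ} (hc : ∀ k, 0 < succDiff c k) :
    (fun k => c k • e₀ 1) ∈ tubeCone 1 n := by
  intro k
  rw [succDiff_map (fun r : ℝ => r • e₀ 1) (fun a b => sub_smul a b _) c k,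
    mem_forwardCone_iff_coneMargin_pos, coneMargin_smul_e₀]
  exact hc k

/-- `η_τ ∘ τ` lies in the base cone (the generator increases along `τ`). [folklore] -/
theorem ητ_perm_mem_tubeCone : (fun k => D.ητ (D.τ k)) ∈ tubeCone 1 n :=
  smul_e₀_mem_tubeCone fun k => D.θ'_pos.trans_le (D.θ'_le_succDiff_Y₁_τ k)

/-- Along `π` the second generator `Y₂ = Y₁ + θ s` is strictly increasing and starts positive:
within a level the positions increase by at least `δ₀` and `θ δ₀ > θ' n`; across levels the first
generator jumps by at least `1 − θ' n > 1/2 ≥ 2 θ M`. [folklore] -/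
theorem succDiff_Y₂_π_pos (k : Fin n) : 0 < succDiff (fun j => D.Y₂ (D.π j)) k := by
  have hN := D.N_pos; have hθ' := D.θ'_pos; have hθ := D.θ_pos
  have hn := D.θ'_n_le; have hθδ := D.θ'_n_le_θ_δ₀; have hθM := D.θ_mul_M
  have hδ₀ := D.δ₀_pos
  cases n with
  | zero => exact k.elim0
  | succ m =>
    refine Fin.cases ?_ (fun j => ?_) k
    · rw [succDiff_zero]
      exact lt_of_lt_of_le (by norm_num) (D.half_le_Y₂ (D.π 0))
    · rw [succDiff_succ]
      set P := D.π j.castSucc with hP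
      set Q := D.π j.succ with hQ
      have hlt : j.castSucc < j.succ := Fin.castSucc_lt_succ (i := j)
      have htPQ : D.t P ≤ D.t Q := D.t_π_mono _ _ hlt.le
      have hrP := D.rank_lt P; have hrQ := D.rank_lt Q
      have hrP0 := D.rank_nonneg P; have hrQ0 := D.rank_nonneg Q
      have hsP := abs_le.1 (D.abs_s_le P); have hsQ := abs_le.1 (D.abs_s_le Q)
      have hNδ := D.N_mul_δ₀
      have hrank : D.θ' * ((D.τ.symm Q : Fin (m + 1)) : ℕ) - D.θ' * ((D.τ.symm P : Fin (m+1)) : ℕ) ≥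
          -(D.θ' * (((m + 1 : ℕ) : ℝ))) := by nlinarith
      unfold Y₂ Y₁
      by_cases heq : D.t P = D.t Q
      · have hs : D.s P < D.s Q := D.s_π_lt _ _ hlt heq
        have hPQ : P ≠ Q := fun h => by
          have := D.π.injective (hP.symm.trans (h.trans hQ))
          exact hlt.ne this
        have hgap : D.δ₀ ≤ D.s Q - D.s P := by
          have := D.gap_s Q P hPQ.symm heq.symm
          rwa [abs_of_pos (sub_pos.2 hs)] at this
        rw [heq]
        have h1 : D.θ * D.δ₀ ≤ D.θ * (D.s Q - D.s P) := mul_le_mul_of_nonneg_left hgap hθ.le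
        nlinarith
      · have hlt' : D.t P < D.t Q := lt_of_le_of_ne htPQ heq
        have hgap : D.δ₀ ≤ D.t Q - D.t P := by
          have := D.gap_t Q P (Ne.symm heq)
          rwa [abs_of_pos (sub_pos.2 hlt')] at this
        have h1 : D.N * (D.t Q - D.t P) ≥ 1 := by nlinarith
        have h2 : D.θ * (D.s Q - D.s P) ≥ -(2 * (D.θ * D.M)) := by nlinarith
        nlinarith

/-- `η_π ∘ π` lies in the base cone. [folklore] -/
theorem ηπ_perm_mem_tubeCone : (fun k => D.ηπ (D.π k)) ∈ tubeCone 1 n :=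
  smul_e₀_mem_tubeCone fun k => D.succDiff_Y₂_π_pos k

/-- The norm of `η_τ` is at most `Yb`. [folklore] -/
theorem norm_ητ_le : ‖D.ητ‖ ≤ D.Yb := by
  refine (pi_norm_le_iff_of_nonneg D.Yb_pos.le).2 fun P => ?_
  show ‖D.Y₁ P • e₀ 1‖ ≤ D.Yb
  rw [norm_smul, Real.norm_eq_abs]
  have he : ‖e₀ 1‖ = 1 := by
    rw [show e₀ 1 = (1 : ℝ) • e₀ 1 by rw [one_smul]]
    have := coneMargin_smul_e₀ (d := 1) 1
    rw [EuclideanSpace.norm_eq, Fin.sum_univ_two]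
    simp [e₀_apply]
  rw [he, mul_one]
  exact D.abs_Y₁_le P

/-! #### Space-like separation within the levels over the real base -/

/-- Over the real base, two distinct points of the same level are space-like separated: their times
differ by at most `2 δX ≤ δ₀/4`, their positions by at least `δ₀ − 2 δX ≥ 3 δ₀/4`. [folklore] -/
theorem isSpacelike_sub_of_mem_O {xr : Fin n → SpaceTime 1} (hxr : xr ∈ D.O) {P Q : Fin n}
    (hPQ : P ≠ Q) (ht : D.t P = D.t Q) : IsSpacelike (xr P - xr Q) := by
  obtain ⟨hP0, hP1⟩ := D.xr_bounds hxr P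
  obtain ⟨hQ0, hQ1⟩ := D.xr_bounds hxr Q
  have hgap := D.gap_s P Q hPQ ht
  have hδ := D.δX_le_δ₀; have hδ₀ := D.δ₀_pos
  refine isSpacelike_of_abs_lt_abs ?_
  simp only [PiLp.sub_apply]
  have h1 : |xr P 0 - xr Q 0| ≤ D.δ₀ / 4 := by
    have := abs_sub (xr P 0) (xr Q 0); linarith
  have h2 : 3 * D.δ₀ / 4 ≤ |xr P 1 - xr Q 1| := by
    have e1 : xr P 1 - xr Q 1 = (D.s P - D.s Q) + ((xr P 1 - D.s P) - (xr Q 1 - D.s Q)) := by ring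
    rw [e1]
    have := abs_sub_abs_le_abs_sub (D.s P - D.s Q) (-( (xr P 1 - D.s P) - (xr Q 1 - D.s Q)))
    rw [sub_neg_eq_add, abs_neg] at this
    have h3 : |(xr P 1 - D.s P) - (xr Q 1 - D.s Q)| ≤ D.δ₀ / 4 := by
      have := abs_sub (xr P 1 - D.s P) (xr Q 1 - D.s Q); linarith
    linarith
  linarith

/-! #### Certificates of the anchor and of the configuration -/

/-- **The anchor is certified for `π`**: for `c > 0` and `ε' = c/(8M)`, the heights
`c Y₁ + ε' s` strictly increase along `π`. [folklore] -/
theorem strictMono_anchor_π {c : ℝ} (hc : 0 < c) :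
    StrictMono fun k => c * D.Y₁ (D.π k) + c / (8 * D.M) * D.s (D.π k) := by
  have hM := D.M_pos; have hN := D.N_pos; have hθ' := D.θ'_pos; have hδ₀ := D.δ₀_pos
  have hn := D.θ'_n_le; have hθδ := D.θ'_n_le_θ_δ₀; have hθM := D.θ_mul_M
  cases n with
  | zero => intro a b hab; exact a.elim0
  | succ m =>
    refine Fin.strictMono_iff_lt_succ.2 fun j => ?_
    set P := D.π j.castSucc with hP
    set Q := D.π j.succ with hQ
    have hlt : j.castSucc < j.succ := Fin.castSucc_lt_succ (i := j)
    have htPQ : D.t P ≤ D.t Q := D.t_π_mono _ _ hlt.le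
    have hrP := D.rank_lt P; have hrQ := D.rank_lt Q
    have hrP0 := D.rank_nonneg P; have hrQ0 := D.rank_nonneg Q
    have hsP := abs_le.1 (D.abs_s_le P); have hsQ := abs_le.1 (D.abs_s_le Q)
    have hNδ := D.N_mul_δ₀
    have hε : 0 < c / (8 * D.M) := by positivity
    have hεM : c / (8 * D.M) * D.M = c / 8 := by field_simp
    show c * D.Y₁ P + c / (8 * D.M) * D.s P < c * D.Y₁ Q + c / (8 * D.M) * D.s Q
    have hrank : c * (D.θ' * ((D.τ.symm Q : Fin (m + 1)) : ℕ)) - c * (D.θ' * ((D.τ.symm P : Fin (m+1)) : ℕ)) ≥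
        -(c * (D.θ' * (((m + 1 : ℕ) : ℝ)))) := by
      have h0 : 0 ≤ c * D.θ' := by positivity
      nlinarith
    -- `θ' n ≤ θ δ₀ / 4 = δ₀ /(16 M)`: the rank disorder is dominated by `ε' δ₀ = c δ₀ /(8M)`
    have hθ'n : c * (D.θ' * (((m + 1 : ℕ) : ℝ))) ≤ c * (D.δ₀ / (16 * D.M)) := by
      refine mul_le_mul_of_nonneg_left ?_ hc.le
      have : D.θ * D.δ₀ / 4 = D.δ₀ / (16 * D.M) := by
        rw [show D.θ = (4 * D.M)⁻¹ from rfl]; field_simp; ring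
      linarith
    unfold Y₁
    by_cases heq : D.t P = D.t Q
    · have hs : D.s P < D.s Q := D.s_π_lt _ _ hlt heq
      have hPQ : P ≠ Q := fun h => by
        have := D.π.injective (hP.symm.trans (h.trans hQ))
        exact hlt.ne this
      have hgap : D.δ₀ ≤ D.s Q - D.s P := by
        have := D.gap_s Q P hPQ.symm heq.symm
        rwa [abs_of_pos (sub_pos.2 hs)] at this
      rw [heq]
      have h1 : c / (8 * D.M) * D.δ₀ ≤ c / (8 * D.M) * (D.s Q - D.s P) :=
        mul_le_mul_of_nonneg_left hgap hε.le
      have h2 : c / (8 * D.M) * D.δ₀ = 2 * (c * (D.δ₀ / (16 * D.M))) := by field_simp; ring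
      nlinarith
    · have hlt' : D.t P < D.t Q := lt_of_le_of_ne htPQ heq
      have hgap : D.δ₀ ≤ D.t Q - D.t P := by
        have := D.gap_t Q P (Ne.symm heq)
        rwa [abs_of_pos (sub_pos.2 hlt')] at this
      have h1 : D.N * (D.t Q - D.t P) ≥ 1 := by nlinarith
      have h2 : c / (8 * D.M) * (D.s Q - D.s P) ≥ -(2 * (c / 8)) := by
        rw [← hεM]; nlinarith
      have h3 : c * (D.δ₀ / (16 * D.M)) ≤ c / 16 := by
        have h4 : D.δ₀ / (16 * D.M) ≤ 1 / 16 := by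
          rw [div_le_div_iff₀ (by positivity) (by norm_num)]
          nlinarith [D.δ₀_le_one, D.one_le_M]
        calc c * (D.δ₀ / (16 * D.M)) ≤ c * (1 / 16) := mul_le_mul_of_nonneg_left h4 hc.le
          _ = c / 16 := by ring
      nlinarith

/-- **The configuration is certified for `π`**: for `0 < ε'` with `4 ε' M < δ₀`, the heights
`t + ε' s` strictly increase along `π`. [folklore] -/
theorem strictMono_config_π {ε' : ℝ} (hε : 0 < ε') (hεM : 4 * ε' * D.M < D.δ₀) :
    StrictMono fun k => D.t (D.π k) + ε' * D.s (D.π k) := by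
  cases n with
  | zero => intro a b hab; exact a.elim0
  | succ m =>
    refine Fin.strictMono_iff_lt_succ.2 fun j => ?_
    set P := D.π j.castSucc with hP
    set Q := D.π j.succ with hQ
    have hlt : j.castSucc < j.succ := Fin.castSucc_lt_succ (i := j)
    have htPQ : D.t P ≤ D.t Q := D.t_π_mono _ _ hlt.le
    have hsP := abs_le.1 (D.abs_s_le P); have hsQ := abs_le.1 (D.abs_s_le Q)
    show D.t P + ε' * D.s P < D.t Q + ε' * D.s Q
    by_cases heq : D.t P = D.t Q
    · have hs : D.s P < D.s Q := D.s_π_lt _ _ hlt heq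
      rw [heq]; nlinarith
    · have hlt' : D.t P < D.t Q := lt_of_le_of_ne htPQ heq
      have hgap : D.δ₀ ≤ D.t Q - D.t P := by
        have := D.gap_t Q P (Ne.symm heq)
        rwa [abs_of_pos (sub_pos.2 hlt')] at this
      nlinarith

/-- **The anchor is certified for `τ`**: for `c > 0` and `0 < ε` with `4 ε M < c θ'`, the heights
`c Y₁ + ε s` strictly increase along `τ`. [folklore] -/
theorem strictMono_anchor_τ {c ε : ℝ} (hc : 0 < c) (hε : 0 < ε) (hεM : 4 * ε * D.M < c * D.θ') :
    StrictMono fun k => c * D.Y₁ (D.τ k) + ε * D.s (D.τ k) := by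
  cases n with
  | zero => intro a b hab; exact a.elim0
  | succ m =>
    refine Fin.strictMono_iff_lt_succ.2 fun j => ?_
    have h1 := D.θ'_le_succDiff_Y₁_τ j.succ
    rw [succDiff_succ] at h1
    have hsP := abs_le.1 (D.abs_s_le (D.τ j.castSucc)); have hsQ := abs_le.1 (D.abs_s_le (D.τ j.succ))
    show c * D.Y₁ (D.τ j.castSucc) + ε * D.s (D.τ j.castSucc) <
      c * D.Y₁ (D.τ j.succ) + ε * D.s (D.τ j.succ)
    have h2 : c * D.θ' ≤ c * (D.Y₁ (D.τ j.succ) - D.Y₁ (D.τ j.castSucc)) :=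
      mul_le_mul_of_nonneg_left h1 hc.le
    nlinarith

end LevelData

end Literature.MathematicalPhysics.QuantumLattice
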